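import Literature.AlgebraicGeometry.Frobenioids.Cor54RigidityReduction
import HarnessLib

/-!
# Frobenioids I, Corollary 5.4 (strong 1-uniqueness at THE data): rigidity along an essentially surjective
# functor from INNER hom-actions — the exact form of the reduction (sub-DAG row C54-core-arith, support lemma)

Mochizuki, *The geometry of Frobenioids I: the general theory*, Kyushu J. Math. **62** (2008) 293–400,
Corollary 5.4, kurims p. 104 ll. 1–9: "there exists a 1-unique functor `Ψ^rlf : C₁^rlf → C₂^rlf` that fits
into a 1-commutative diagram […]". [cite: MochizukiFrdI2008, Cor. 5.4 p.104]

PROOF-ONLY file (seat abc-iut-w5-d227, spec author of the row; pure category theory over Mathlib, no definitions).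
`Cor54RigidityReduction.lean` (seat abc-iut-w5-d048) reduces rigidity along an essentially surjective `G : A ⥤ E`
(`∀ T, G ⋙ T ≅ G → T ≅ 𝟭`, the `hrig` input of `FrdI.Cor54Sub.strongUnique_of_rigidAlong_untrToRlf`) to
HOM-RIGIDITY of the image: every functorial self-map `ρ` of the morphisms between `G`-image objects fixing the
`G f` is the IDENTITY. That sufficient condition is stronger than necessary (it also forbids the conjugations
`h ↦ e_a⁻¹ ≫ h ≫ e_{a'}` by automorphisms `e` of the functor `G`). This file records the EXACT form:

* `FrdI.Cor54Sub.rigidAlong_of_essSurj_of_homInner` — if `G` is essentially surjective and every such `ρ` is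
  INNER, i.e. `ρ h = e_a ≫ h ≫ e_{a'}⁻¹` for SOME family of automorphisms `e_a : G a ≅ G a` (no naturality is asked
  of `e`), then every `T` with `G ⋙ T ≅ G` is `≅ 𝟭` (apply `nonempty_iso_id_of_essSurj_of_conj_eq` to the family
  `θ_a ≫ e_a`, whose conjugate is the identity);
* `FrdI.Cor54Sub.homInner_conj_of_iso_id` — conversely, if `T ≅ 𝟭` then the `θ`-conjugate `ρ` of `T` is inner for
  every `θ : G ⋙ T ≅ G`; so for essentially surjective `G`, "every `θ`-conjugate is inner" is EQUIVALENT to rigidity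
  along `G` (`rigidAlong_iff_conj_homInner`).
Hence the row's file (4) may prove, at `C_{K/F}`, that `ρ` is inner (in particular `ρ = id` suffices) without
deciding whether `untrToRlf` has non-trivial automorphisms. Nothing here bears on [IUTchIII] Cor. 3.12.
-/

namespace Literature.AlgebraicGeometry.Frobenioids

namespace FrdI.Cor54Sub

open CategoryTheory

universe v₁ v₂ u₁ u₂

variable {A : Type u₁} [Category.{v₁} A] {E : Type u₂} [Category.{v₂} E] (G : A ⥤ E)

/-- **Rigidity along an essentially surjective `G` from INNER hom-actions of its image.** Suppose `G` is
essentially surjective and every functorial self-map `ρ` of the morphisms between `G`-image objects which fixes the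
morphisms `G f` is inner: `ρ h = e_a ≫ h ≫ e_{a'}⁻¹` for some family of automorphisms `e_a` of the objects `G a`.
Then every endofunctor `T` of `E` with `G ⋙ T ≅ G` is `≅ 𝟭 E`. [cite: MochizukiFrdI2008, Cor. 5.4 p.104] -/
theorem rigidAlong_of_essSurj_of_homInner [G.EssSurj]
    (H : ∀ ρ : ∀ ⦃a a' : A⦄, (G.obj a ⟶ G.obj a') → (G.obj a ⟶ G.obj a'),
      (∀ ⦃a a' a'' : A⦄ (h : G.obj a ⟶ G.obj a') (k : G.obj a' ⟶ G.obj a''), ρ (h ≫ k) = ρ h ≫ ρ k) →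
      (∀ ⦃a a' : A⦄ (f : a ⟶ a'), ρ (G.map f) = G.map f) →
        ∃ e : ∀ a : A, G.obj a ≅ G.obj a,
          ∀ ⦃a a' : A⦄ (h : G.obj a ⟶ G.obj a'), ρ h = (e a).hom ≫ h ≫ (e a').inv) :
    ∀ T : E ⥤ E, Nonempty (G ⋙ T ≅ G) → Nonempty (T ≅ 𝟭 E) := by
  rintro T ⟨θ⟩
  -- the components of `θ`, retyped at `T (G a)` (definitionally `(G ⋙ T) a`)
  let η : ∀ a : A, T.obj (G.obj a) ≅ G.obj a := fun a =>
    ⟨θ.hom.app a, θ.inv.app a, θ.hom_inv_id_app a, θ.inv_hom_id_app a⟩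
  have hη : ∀ ⦃a a' : A⦄ (f : a ⟶ a'), T.map (G.map f) ≫ (η a').hom = (η a).hom ≫ G.map f :=
    fun a a' f => θ.hom.naturality f
  -- the `θ`-conjugate of `T` is functorial and fixes the `G f`, hence inner by hypothesis
  obtain ⟨e, he⟩ := H (fun a a' h => (η a).inv ≫ T.map h ≫ (η a').hom)
    (fun a a' a'' h k => conj_comp G T η h k) (fun a a' f => conj_map G T η hη f)
  -- the corrected family `θ_a ≫ e_a` has identity conjugate
  refine nonempty_iso_id_of_essSurj_of_conj_eq G T (fun a => η a ≪≫ e a) ?_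
  intro a a' h
  have h1 : (η a).inv ≫ T.map h ≫ (η a').hom = (e a).hom ≫ h ≫ (e a').inv := he h
  calc (η a ≪≫ e a).inv ≫ T.map h ≫ (η a' ≪≫ e a').hom
      = (e a).inv ≫ ((η a).inv ≫ T.map h ≫ (η a').hom) ≫ (e a').hom := by
        simp only [Iso.trans_inv, Iso.trans_hom, Category.assoc]
    _ = (e a).inv ≫ ((e a).hom ≫ h ≫ (e a').inv) ≫ (e a').hom := by rw [h1]
    _ = h := by simp only [Category.assoc, Iso.inv_hom_id_assoc, Iso.inv_hom_id, Category.comp_id]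

/-- Variant with essential surjectivity as a bare existence statement. [cite: MochizukiFrdI2008, Cor. 5.4 p.104] -/
theorem rigidAlong_of_exists_iso_of_homInner (hess : ∀ Y : E, ∃ a : A, Nonempty (G.obj a ≅ Y))
    (H : ∀ ρ : ∀ ⦃a a' : A⦄, (G.obj a ⟶ G.obj a') → (G.obj a ⟶ G.obj a'),
      (∀ ⦃a a' a'' : A⦄ (h : G.obj a ⟶ G.obj a') (k : G.obj a' ⟶ G.obj a''), ρ (h ≫ k) = ρ h ≫ ρ k) →
      (∀ ⦃a a' : A⦄ (f : a ⟶ a'), ρ (G.map f) = G.map f) →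
        ∃ e : ∀ a : A, G.obj a ≅ G.obj a,
          ∀ ⦃a a' : A⦄ (h : G.obj a ⟶ G.obj a'), ρ h = (e a).hom ≫ h ≫ (e a').inv) :
    ∀ T : E ⥤ E, Nonempty (G ⋙ T ≅ G) → Nonempty (T ≅ 𝟭 E) := by
  haveI : G.EssSurj := ⟨fun Y => hess Y⟩
  exact rigidAlong_of_essSurj_of_homInner G H

/-- Hom-rigidity (`ρ = id`, the hypothesis of `rigidAlong_of_essSurj_of_homRigid`) is the special case `e = 1` of
inner-ness. [cite: MochizukiFrdI2008, Cor. 5.4 p.104] -/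
theorem homInner_of_homRigid (ρ : ∀ ⦃a a' : A⦄, (G.obj a ⟶ G.obj a') → (G.obj a ⟶ G.obj a'))
    (hρ : ∀ ⦃a a' : A⦄ (h : G.obj a ⟶ G.obj a'), ρ h = h) :
    ∃ e : ∀ a : A, G.obj a ≅ G.obj a,
      ∀ ⦃a a' : A⦄ (h : G.obj a ⟶ G.obj a'), ρ h = (e a).hom ≫ h ≫ (e a').inv :=
  ⟨fun a => Iso.refl _, fun a a' h => by rw [hρ, Iso.refl_hom, Iso.refl_inv, Category.id_comp, Category.comp_id]⟩

variable (T : E ⥤ E)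

/-- **Converse**: if `T ≅ 𝟭 E`, then for EVERY family `η_a : T (G a) ≅ G a` the `η`-conjugate of `T` is inner
(with `e_a := η_a⁻¹ ≫ τ_{G a}` for `τ : T ≅ 𝟭`). [cite: MochizukiFrdI2008, Cor. 5.4 p.104] -/
theorem homInner_conj_of_iso_id (τ : T ≅ 𝟭 E) (η : ∀ a : A, T.obj (G.obj a) ≅ G.obj a) :
    ∃ e : ∀ a : A, G.obj a ≅ G.obj a,
      ∀ ⦃a a' : A⦄ (h : G.obj a ⟶ G.obj a'),
        (η a).inv ≫ T.map h ≫ (η a').hom = (e a).hom ≫ h ≫ (e a').inv := by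
  -- `τ` at image objects, retyped at `G a` (definitionally `(𝟭 E) (G a)`)
  let t : ∀ a : A, T.obj (G.obj a) ≅ G.obj a := fun a =>
    ⟨τ.hom.app (G.obj a), τ.inv.app (G.obj a), τ.hom_inv_id_app (G.obj a), τ.inv_hom_id_app (G.obj a)⟩
  have hnat : ∀ {a a' : A} (h : G.obj a ⟶ G.obj a'), T.map h ≫ (t a').hom = (t a).hom ≫ h :=
    fun h => τ.hom.naturality h
  refine ⟨fun a => (η a).symm ≪≫ t a, fun a a' h => ?_⟩
  -- `η⁻¹ ≫ T h ≫ η' = (η⁻¹ ≫ t) ≫ h ≫ (t'⁻¹ ≫ η')`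
  have h2 : T.map h = (t a).hom ≫ h ≫ (t a').inv := by
    rw [← Category.assoc, ← hnat h, Category.assoc, Iso.hom_inv_id, Category.comp_id]
  rw [h2]
  simp only [Iso.trans_hom, Iso.trans_inv, Iso.symm_hom, Iso.symm_inv, Category.assoc]

/-- **For essentially surjective `G`, rigidity along `G` ⟺ every conjugate of an endofunctor over `G` is inner.**
Precisely: (∀ T, (G ⋙ T ≅ G) → T ≅ 𝟭) iff for every `T` and every `θ : G ⋙ T ≅ G` the `θ`-conjugate of `T` on
the morphisms between image objects is inner. [cite: MochizukiFrdI2008, Cor. 5.4 p.104] -/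
theorem rigidAlong_iff_conj_homInner [G.EssSurj] :
    (∀ T : E ⥤ E, Nonempty (G ⋙ T ≅ G) → Nonempty (T ≅ 𝟭 E)) ↔
      ∀ (T : E ⥤ E) (θ : G ⋙ T ≅ G), ∃ e : ∀ a : A, G.obj a ≅ G.obj a,
        ∀ ⦃a a' : A⦄ (h : G.obj a ⟶ G.obj a'),
          θ.inv.app a ≫ T.map h ≫ θ.hom.app a' = (e a).hom ≫ h ≫ (e a').inv := by
  constructor
  · intro hrig T θ
    obtain ⟨τ⟩ := hrig T ⟨θ⟩
    let η : ∀ a : A, T.obj (G.obj a) ≅ G.obj a := fun a =>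
      ⟨θ.hom.app a, θ.inv.app a, θ.hom_inv_id_app a, θ.inv_hom_id_app a⟩
    exact homInner_conj_of_iso_id G T τ η
  · rintro H T ⟨θ⟩
    let η : ∀ a : A, T.obj (G.obj a) ≅ G.obj a := fun a =>
      ⟨θ.hom.app a, θ.inv.app a, θ.hom_inv_id_app a, θ.inv_hom_id_app a⟩
    obtain ⟨e, he⟩ := H T θ
    refine nonempty_iso_id_of_essSurj_of_conj_eq G T (fun a => η a ≪≫ e a) ?_
    intro a a' h
    have h1 : (η a).inv ≫ T.map h ≫ (η a').hom = (e a).hom ≫ h ≫ (e a').inv := he h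
    calc (η a ≪≫ e a).inv ≫ T.map h ≫ (η a' ≪≫ e a').hom
        = (e a).inv ≫ ((η a).inv ≫ T.map h ≫ (η a').hom) ≫ (e a').hom := by
          simp only [Iso.trans_inv, Iso.trans_hom, Category.assoc]
      _ = (e a).inv ≫ ((e a).hom ≫ h ≫ (e a').inv) ≫ (e a').hom := by rw [h1]
      _ = h := by simp only [Category.assoc, Iso.inv_hom_id_assoc, Iso.inv_hom_id, Category.comp_id]

end FrdI.Cor54Sub

end Literature.AlgebraicGeometry.Frobenioids
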